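import Literature.AlgebraicGeometry.ShimuraVarieties.UnitaryShimuraCurveHeckePoints
import Literature.NumberTheory.Automorphic.UnitaryGroupRationalRepresentatives
import Literature.AlgebraicGeometry.HodgeTheory.ComplexPointsLifting
import HarnessLib

/-!
# Complex points of the level transitions of the canonical model of the unitary Shimura CURVE `Sh(U(J⋆), 𝔻)`:
# onto, with fibres the `K`-orbits; same-piece pairs lift along the transitions

Topic `AlgebraicGeometry/ShimuraVarieties`, namespace `Literature.AlgebraicGeometry.ShimuraVarieties.UnitaryCanonicalModel`
(object: the rank-2 record system `RecordSystemGS L Jstar τ K₀` of `UnitaryShimuraCurveRecord.lean`, in CONE coordinates).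
PROOF FILE: theorems only — no definition, no named fact, no instance, no `sorry`.  The rank-2, cone-coordinate twin of
`UnitaryShimuraLevelFibres.lean` §§1–4 (rank 3, ball coordinates) and of the §1 lemma `recordSystem_pieces_pair_lift` of
`Summits/…/HypLiu418/A3Liu418AlbTransitionEpi.lean`, WITHOUT any Hecke-translate predicate (translates enter §2 only as an
explicit family with its point formula as a hypothesis).  Everything is POINT ALGEBRA on
`Sh_K(ℂ) = U(J⋆)(L⁺) \ [𝔻 × U(J⋆)(𝔸_{L⁺,f})/K]` (`ShimuraSetGS`, `ShimuraSetGS.mk_eq_mk_iff`, [Milne2005ShimuraVarieties] §5,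
Lemma 5.13) read through the record's clauses `pts` / `map_pts` / `pieces` ([Deligne1979ShimuraVarieties] 2.1.2–2.1.4).

* §1 `ShimuraSetGS.mk_eq_mk_of_le`, `ShimuraSetGS.mk_eq_mk_iff_exists_mem` — the level change `[v, aN] ↦ [v, aK]` (`N ≤ K`) is well
  defined and its fibres are the right `K`-translates ([Milne2005ShimuraVarieties] Rem. 5.29 (c); [Deligne1979ShimuraVarieties] 2.7.1 (c)).
* §2 `RecordSystemGS.exists_eq_pts_symm_mk`, `map_pts_symm`, `map_complexPoints_surjective`, `map_complexPoints_eq_iff`,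
  `map_complexPoints_eq_iff_of_translates` — the transitions `M_N ⟶ M_K` are onto on complex points with fibres the `K/N`-orbits.
* §3 `RecordSystemGS.pieces_pair_lift` — for `f : K' ⟶ K`, the complex fibre `(M_K)_τ` is the coproduct of geometrically
  irreducible pieces (the disc quotients `X_q` of the clause `pieces`), and any two complex points of one piece are images under
  `(M_{K'} ⟶ M_K)_τ` of two complex points of ONE piece of `(M_{K'})_τ` — verbatim the input `hlift` of the tree's generic engine
  `Liu2021.AppendixC.Sec42Data.epi_Atr_of_pieces_lift_iso` (`Liu2021/NablaMapSurjectiveOfPieces.lean`; [Liu2021] Thm. 4.18 (1),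
  «`Alb_u` is an epimorphism»), at relative dimension 1.

Use (cell `hodgecm-mathlib`, GS programme, census `A-provers/A-p01/CENSUS-GS4-reldim1-inputs.A-p01g4.md` rows T2a / T4a): the
next-shift GS-4 typer's `albTransitionEpi_GS` and level-quotient twin consume §§2–3 by name.  Banked generic leaf (books 0);
HC_CM is proved only modulo the 7 printed citations until rung 0 closes.

## References
* [Deligne1979ShimuraVarieties] P. Deligne, *Variétés de Shimura* (1979), 2.1.2–2.1.4, 2.7.1 (c).
* [Milne2005ShimuraVarieties] J. S. Milne, *Introduction to Shimura varieties* (2005), §5 p. 57 L7–12, p. 58 L3–11, Lemma 5.13,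
  Rem. 5.29 (a), (c) p. 65.
* [GenestierNgo2020Lectures] A. Genestier, B. C. Ngô, *Lectures on Shimura varieties*, §4.6 Lemma 4.6.1.
* [Liu2021] Y. Liu, *Fourier–Jacobi cycles and arithmetic relative trace formula*, Camb. J. Math. 9 (2021), Thm. 4.18 (1)
  (FJcycle.tex l. 2247–2282), Def. 2.3.
-/

set_option autoImplicit false

noncomputable section

open Function MulAction Topology NumberField IsDedekindDomain CategoryTheory CategoryTheory.Limits Matrix AlgebraicGeometry
open scoped Matrix ComplexOrder
open Literature.AlgebraicGeometry.Motives
open Literature.NumberTheory.Automorphic Literature.NumberTheory.Automorphic.UnitaryGroup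
open Literature.NumberTheory.Automorphic.ShimuraDissection
open Literature.NumberTheory.Automorphic.Liu2021.AppendixC (C5.OpenCompactSubgroup C5.SmallLevel)

namespace Literature.AlgebraicGeometry.ShimuraVarieties

namespace UnitaryCanonicalModel

/-! ## §1. Point algebra on `Sh_K(U(J⋆), 𝔻)(ℂ)`: the level change and its fibres -/

section PointAlgebra

variable (L : Type) [Field L] [NumberField L] [IsCMField L] (Jstar : Matrix (Fin 2) (Fin 2) L) (τ : L →+* ℂ)

/-- **The level change `[v, aN] ↦ [v, aK]` is well defined for `N ≤ K`** (the transition `Sh_N(ℂ) → Sh_K(ℂ)`,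
[Milne2005ShimuraVarieties] §5 p. 58 L3–6; [Deligne1979ShimuraVarieties] 2.1.4): equal classes at level `N` stay equal at level `K`
(same witnesses `γ`, `c` in `ShimuraSetGS.mk_eq_mk_iff`). [cite: Milne2005ShimuraVarieties, §5 p. 58 L3–6]
[cite: Deligne1979ShimuraVarieties, 2.1.4] -/
theorem ShimuraSetGS.mk_eq_mk_of_le {N K : Subgroup ↥(finAdelic (↥(maximalRealSubfield L)) L (IsCMField.complexConj L) 2 Jstar)}
    (hNK : N ≤ K) {v v' : Fin 2 → ℂ} {hv : v ∈ negCone (Jstar.map τ)} {hv' : v' ∈ negCone (Jstar.map τ)}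
    {a a' : ↥(finAdelic (↥(maximalRealSubfield L)) L (IsCMField.complexConj L) 2 Jstar)}
    (h : ShimuraSetGS.mk L Jstar τ N v hv a = ShimuraSetGS.mk L Jstar τ N v' hv' a') :
    ShimuraSetGS.mk L Jstar τ K v hv a = ShimuraSetGS.mk L Jstar τ K v' hv' a' := by
  obtain ⟨γ, c, hc, hcv, hcoset⟩ := (ShimuraSetGS.mk_eq_mk_iff L Jstar τ N v v' hv hv' a a').1 h
  refine (ShimuraSetGS.mk_eq_mk_iff L Jstar τ K v v' hv hv' a a').2 ⟨γ, c, hc, hcv, ?_⟩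
  rw [MulAction.Quotient.smul_coe] at hcoset ⊢
  exact QuotientGroup.eq.2 (hNK (QuotientGroup.eq.1 hcoset))

/-- **Two classes of level `N ≤ K` have the same image at level `K` iff they differ by a right translation by an element of `K`**:
`[v, aK] = [v′, a′K] ↔ ∃ k ∈ K, [v′, a′N] = [v, akN]` (from `ShimuraSetGS.mk_eq_mk_iff`: `c · γ^τ v′ = v` and `k := a⁻¹ γ a′ ∈ K`, so
`[v′, a′N] = [c γ^τ v′, γ a′N] = [v, akN]` by `ShimuraSetGS.mk_smul_mulVec`; conversely `[v, akK] = [v, aK]`, ★ `ShimuraSetGS.mk_mul_of_mem`).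
The point-set content of [Milne2005ShimuraVarieties] Rem. 5.29 (c) «`S_K` is the quotient of `S_{K′}` by the action of `K/K′`»
([Deligne1979ShimuraVarieties] 2.7.1 (c)), for the curve datum `U(J⋆)`.
[cite: Milne2005ShimuraVarieties, Rem. 5.29 (c) p. 65 and §5 p. 58 L3–11] [cite: Deligne1979ShimuraVarieties, 2.1.4 and 2.7.1 (c)] -/
theorem ShimuraSetGS.mk_eq_mk_iff_exists_mem
    {N K : Subgroup ↥(finAdelic (↥(maximalRealSubfield L)) L (IsCMField.complexConj L) 2 Jstar)} (hNK : N ≤ K)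
    (v v' : Fin 2 → ℂ) (hv : v ∈ negCone (Jstar.map τ)) (hv' : v' ∈ negCone (Jstar.map τ))
    (a a' : ↥(finAdelic (↥(maximalRealSubfield L)) L (IsCMField.complexConj L) 2 Jstar)) :
    ShimuraSetGS.mk L Jstar τ K v hv a = ShimuraSetGS.mk L Jstar τ K v' hv' a' ↔
      ∃ k ∈ K, ShimuraSetGS.mk L Jstar τ N v' hv' a' = ShimuraSetGS.mk L Jstar τ N v hv (a * k) := by
  constructor
  · intro h
    obtain ⟨γ, c, hc, hcv, hcoset⟩ := (ShimuraSetGS.mk_eq_mk_iff L Jstar τ K v v' hv hv' a a').1 h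
    rw [MulAction.Quotient.smul_coe] at hcoset
    -- `k := a⁻¹ γ a′ ∈ K`
    have hk : a⁻¹ * ((rationalToFinAdelic (↥(maximalRealSubfield L)) L (IsCMField.complexConj L) 2 Jstar γ :
        ↥(finAdelic (↥(maximalRealSubfield L)) L (IsCMField.complexConj L) 2 Jstar)) * a') ∈ K := by
      have h1 := QuotientGroup.eq.1 hcoset
      have h2 := K.inv_mem h1
      rwa [_root_.mul_inv_rev, inv_inv] at h2
    refine ⟨_, hk, ?_⟩
    rw [mul_inv_cancel_left]
    -- `[v′, a′N] = [c γ^τ v′, γ a′ N] = [v, γ a′ N]`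
    have hγv : c • ((((ratToGLℂ L Jstar τ γ : GL (Fin 2) ℂ)) : Matrix (Fin 2) (Fin 2) ℂ) *ᵥ v') ∈ negCone (Jstar.map τ) :=
      smul_ratToGLℂ_mulVec_mem_negCone L Jstar τ γ hc hv'
    have hm := ShimuraSetGS.mk_smul_mulVec L Jstar τ N γ hc v' hv' hγv a'
    rw [← hm]
    -- the vector `c • γ^τ v′` IS `v`
    simp only [hcv]
  · rintro ⟨k, hk, h⟩
    rw [← ShimuraSetGS.mk_mul_of_mem L Jstar τ K v hv a hk]
    exact ShimuraSetGS.mk_eq_mk_of_le L Jstar τ hNK h.symm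

end PointAlgebra

/-! ## §2. Complex points of `M_K` are the `pts⁻¹[v, aK]`; the transitions are onto with fibres the `K`-orbits -/

variable {L : Type} [Field L] [NumberField L] [IsCMField L] {Jstar : Matrix (Fin 2) (Fin 2) L} {τ : L →+* ℂ}
  {K₀ : C5.OpenCompactSubgroup ↥(finAdelic (↥(maximalRealSubfield L)) L (IsCMField.complexConj L) 2 Jstar)}

namespace RecordSystemGS

/-- Every complex point of `M_K` (along `τ`) is `pts_K⁻¹ [v, aK]` for some negative vector `v` of `J⋆^τ` and some
`a ∈ U(J⋆)(𝔸_{L⁺,f})` (the clause `pts` is a bijection onto `Sh_K(ℂ)` and `[v, aK]` exhausts `Sh_K(ℂ)`, `ShimuraSetGS.mk_surjective`).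
[cite: Deligne1979ShimuraVarieties, 2.1.2] [cite: Milne2005ShimuraVarieties, Lemma 5.13 p. 57] -/
theorem exists_eq_pts_symm_mk (S : RecordSystemGS L Jstar τ K₀) (K : C5.SmallLevel K₀)
    (x : letI : Algebra L ℂ := τ.toAlgebra; ComplexPoints (S.M.obj K)) :
    letI : Algebra L ℂ := τ.toAlgebra
    ∃ (v : Fin 2 → ℂ) (hv : v ∈ negCone (Jstar.map τ))
      (a : ↥(finAdelic (↥(maximalRealSubfield L)) L (IsCMField.complexConj L) 2 Jstar)),
      x = (S.pts K).symm (ShimuraSetGS.mk L Jstar τ K.1.1 v hv a) := by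
  letI : Algebra L ℂ := τ.toAlgebra
  obtain ⟨v, hv, a, hx⟩ := ShimuraSetGS.mk_surjective L Jstar τ K.1.1 (S.pts K x)
  exact ⟨v, hv, a, by rw [← Homeomorph.symm_apply_apply (S.pts K) x, ← hx]⟩

/-- The transition morphism `M_N ⟶ M_K` (`N ≤ K`) sends `pts_N⁻¹ [v, aN]` to `pts_K⁻¹ [v, aK]` (the clause `map_pts`, read through
`pts_K⁻¹`). [cite: Deligne1979ShimuraVarieties, 2.1.4] [cite: Milne2005ShimuraVarieties, §5 p. 58 L3–6] -/
theorem map_pts_symm (S : RecordSystemGS L Jstar τ K₀) {N K : C5.SmallLevel K₀} (f : N ⟶ K) (v : Fin 2 → ℂ)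
    (hv : v ∈ negCone (Jstar.map τ)) (a : ↥(finAdelic (↥(maximalRealSubfield L)) L (IsCMField.complexConj L) 2 Jstar)) :
    letI : Algebra L ℂ := τ.toAlgebra
    AlgPoints.map (S.M.map f) ((S.pts N).symm (ShimuraSetGS.mk L Jstar τ N.1.1 v hv a)) =
      (S.pts K).symm (ShimuraSetGS.mk L Jstar τ K.1.1 v hv a) := by
  letI : Algebra L ℂ := τ.toAlgebra
  apply (S.pts K).injective
  rw [S.map_pts N K f v hv a, Homeomorph.apply_symm_apply]

/-- **`M_N(ℂ) → M_K(ℂ)` is surjective** (`N ≤ K`): `pts_K⁻¹[v, aK]` is the image of `pts_N⁻¹[v, aN]` ([Milne2005ShimuraVarieties] Rem. 5.29 (a)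
«an obvious quotient map `S_{K′} → S_K`»). [cite: Milne2005ShimuraVarieties, Rem. 5.29 (a) p. 65 and §5 p. 58 L3–6]
[cite: Deligne1979ShimuraVarieties, 2.1.4] -/
theorem map_complexPoints_surjective (S : RecordSystemGS L Jstar τ K₀) {N K : C5.SmallLevel K₀} (f : N ⟶ K) :
    letI : Algebra L ℂ := τ.toAlgebra
    Function.Surjective (AlgPoints.map (S.M.map f) : ComplexPoints (S.M.obj N) → ComplexPoints (S.M.obj K)) := by
  letI : Algebra L ℂ := τ.toAlgebra
  intro y
  obtain ⟨v, hv, a, rfl⟩ := S.exists_eq_pts_symm_mk K y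
  exact ⟨(S.pts N).symm (ShimuraSetGS.mk L Jstar τ N.1.1 v hv a), S.map_pts_symm f v hv a⟩

/-- **The fibres of `M_N(ℂ) → M_K(ℂ)` are the right `K`-orbits**: two complex points of `M_N` have the same image in `M_K` iff they are
`pts_N⁻¹[v, aN]` and `pts_N⁻¹[v, akN]` for some `v`, `a` and some `k ∈ K` ([Milne2005ShimuraVarieties] Rem. 5.29 (c): `S_K(ℂ) = S_N(ℂ)/(K/N)`).
[cite: Milne2005ShimuraVarieties, Rem. 5.29 (c) p. 65] [cite: Deligne1979ShimuraVarieties, 2.7.1 (c)] -/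
theorem map_complexPoints_eq_iff (S : RecordSystemGS L Jstar τ K₀) {N K : C5.SmallLevel K₀} (f : N ⟶ K)
    (x x' : letI : Algebra L ℂ := τ.toAlgebra; ComplexPoints (S.M.obj N)) :
    letI : Algebra L ℂ := τ.toAlgebra
    AlgPoints.map (S.M.map f) x = AlgPoints.map (S.M.map f) x' ↔
      ∃ k ∈ K.1.1, ∃ (v : Fin 2 → ℂ) (hv : v ∈ negCone (Jstar.map τ))
        (a : ↥(finAdelic (↥(maximalRealSubfield L)) L (IsCMField.complexConj L) 2 Jstar)),
        x = (S.pts N).symm (ShimuraSetGS.mk L Jstar τ N.1.1 v hv a) ∧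
          x' = (S.pts N).symm (ShimuraSetGS.mk L Jstar τ N.1.1 v hv (a * k)) := by
  letI : Algebra L ℂ := τ.toAlgebra
  have hNK : N.1.1 ≤ K.1.1 := fun x hx => (show N.1 ≤ K.1 from f.le) hx
  constructor
  · intro h
    obtain ⟨v, hv, a, rfl⟩ := S.exists_eq_pts_symm_mk N x
    obtain ⟨v', hv', a', rfl⟩ := S.exists_eq_pts_symm_mk N x'
    rw [S.map_pts_symm f v hv a, S.map_pts_symm f v' hv' a'] at h
    obtain ⟨k, hk, hk'⟩ :=
      (ShimuraSetGS.mk_eq_mk_iff_exists_mem L Jstar τ hNK v v' hv hv' a a').1 ((S.pts K).symm.injective h)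
    exact ⟨k, hk, v, hv, a, rfl, congrArg (S.pts N).symm hk'⟩
  · rintro ⟨k, hk, v, hv, a, hx, hx'⟩
    rw [hx, hx']
    exact (S.map_pts_symm f v hv a).trans
      (((S.map_pts_symm f v hv (a * k)).trans
        (congrArg (S.pts K).symm (ShimuraSetGS.mk_mul_of_mem L Jstar τ K.1.1 v hv a hk))).symm)

/-- **The fibres of `M_N(ℂ) → M_K(ℂ)` are the orbits of any family of translates `T_k`, `k ∈ K`, acting as `[v, aN] ↦ [v, akN]`**
(the translates given as an explicit family of `L`-morphisms with their point formula as hypothesis; [Milne2005ShimuraVarieties] Rem. 5.29 (c),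
[Deligne1979ShimuraVarieties] 2.7.1 (c) «`(K/L)\S_L ⥲ S_K`» on complex points).
[cite: Milne2005ShimuraVarieties, Rem. 5.29 (c) p. 65] [cite: Deligne1979ShimuraVarieties, 2.7.1 (c)] -/
theorem map_complexPoints_eq_iff_of_translates (S : RecordSystemGS L Jstar τ K₀) {N K : C5.SmallLevel K₀} (f : N ⟶ K)
    (Tr : ∀ k ∈ K.1.1, (S.M.obj N ⟶ S.M.obj N))
    (hTr : letI : Algebra L ℂ := τ.toAlgebra
      ∀ k (hk : k ∈ K.1.1) (v : Fin 2 → ℂ) (hv : v ∈ negCone (Jstar.map τ))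
        (a : ↥(finAdelic (↥(maximalRealSubfield L)) L (IsCMField.complexConj L) 2 Jstar)),
        S.pts N (AlgPoints.map (Tr k hk) ((S.pts N).symm (ShimuraSetGS.mk L Jstar τ N.1.1 v hv a))) =
          ShimuraSetGS.mk L Jstar τ N.1.1 v hv (a * k))
    (x x' : letI : Algebra L ℂ := τ.toAlgebra; ComplexPoints (S.M.obj N)) :
    letI : Algebra L ℂ := τ.toAlgebra
    AlgPoints.map (S.M.map f) x = AlgPoints.map (S.M.map f) x' ↔ ∃ (k : _) (hk : k ∈ K.1.1), AlgPoints.map (Tr k hk) x = x' := by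
  letI : Algebra L ℂ := τ.toAlgebra
  have hT : ∀ k (hk : k ∈ K.1.1) (v : Fin 2 → ℂ) (hv : v ∈ negCone (Jstar.map τ))
      (a : ↥(finAdelic (↥(maximalRealSubfield L)) L (IsCMField.complexConj L) 2 Jstar)),
      AlgPoints.map (Tr k hk) ((S.pts N).symm (ShimuraSetGS.mk L Jstar τ N.1.1 v hv a)) =
        (S.pts N).symm (ShimuraSetGS.mk L Jstar τ N.1.1 v hv (a * k)) := fun k hk v hv a => by
    apply (S.pts N).injective
    rw [hTr k hk v hv a, Homeomorph.apply_symm_apply]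
  rw [S.map_complexPoints_eq_iff f x x']
  constructor
  · rintro ⟨k, hk, v, hv, a, rfl, rfl⟩
    exact ⟨k, hk, hT k hk v hv a⟩
  · rintro ⟨k, hk, rfl⟩
    obtain ⟨v, hv, a, rfl⟩ := S.exists_eq_pts_symm_mk N x
    exact ⟨k, hk, v, hv, a, rfl, hT k hk v hv a⟩

/-! ## §3. Same-piece pairs of complex points lift along the transitions -/

set_option maxHeartbeats 1600000 in -- large adelic / Shimura-set terms in the record's `pieces` clause (as the rank-3 twin)
/-- **Same-piece pairs of complex points lift along the transition morphisms of the curve's models.**  For a record system `S` of the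
models `M_K` of `Sh(U(J⋆), 𝔻)` ([Deligne1979ShimuraVarieties] 2.1.2–2.1.4, typed as `RecordSystemGS`) and `f : K' ⟶ K` (`K' ≤ K ≤ K₀`):
the complex fibre `M_K ⊗_{L,τ} ℂ` is the coproduct of geometrically irreducible pieces (the disc quotients `X_q` of the clause `pieces`,
smooth projective curves), `M_{K'} ⊗_{L,τ} ℂ` receives the geometrically irreducible pieces `X'_{q'}`, and any two complex points of one
`X_q` are the images under `(M_{K'} → M_K) ⊗ ℂ` of two complex points of one `X'_{q'}`.  KERNEL (cone coordinates): a complex point of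
`X_q` is `unif v` for a negative vector `v` (`surjOn_unif`), i.e. `[v, g_q K]` in `Sh_K(ℂ)` (point formula of `pieces`); at level `K'` the
class `q' = [g_q]` has `[v, g_q K'] = [γ^τ v, g'_{q'} K']` for a rational `γ` (★ `UnitaryGroup.exists_rational_smul_rep_mem` +
`ShimuraSetGS.mk_smul_mulVec`, `ShimuraSetGS.mk_mul_of_mem`), and the transition is `[v, aK'] ↦ [v, aK]` (`map_pts`).  This is exactly the input `hlift` of
`Liu2021.AppendixC.Sec42Data.epi_Atr_of_pieces_lift_iso` at relative dimension 1.
[cite: Deligne1979ShimuraVarieties, 2.1.2–2.1.4] [cite: Milne2005ShimuraVarieties, Lemma 5.13 p. 57]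
[cite: Liu2021, Thm. 4.18 (1) proof (FJcycle.tex l. 2247–2282) and Def. 2.3] -/
theorem pieces_pair_lift (S : RecordSystemGS L Jstar τ K₀) {K K' : C5.SmallLevel K₀} (f : K' ⟶ K) :
    ∃ (κ κ' : Type) (P : κ → SchemeOver ℂ) (P' : κ' → SchemeOver ℂ)
      (inj : ∀ c, P c ⟶ (baseChangeHom τ).obj (S.M.obj K)) (_ : ∀ c, GeometricallyIrreducible (P c).hom)
      (_ : IsColimit (Cofan.mk ((baseChangeHom τ).obj (S.M.obj K)) inj))
      (inj' : ∀ c', P' c' ⟶ (baseChangeHom τ).obj (S.M.obj K')) (_ : ∀ c', GeometricallyIrreducible (P' c').hom),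
      ∀ (c : κ) (z₁ z₂ : ComplexPoints (P c)), ∃ (c' : κ') (z₁' z₂' : ComplexPoints (P' c')),
        AlgPoints.map (inj' c' ≫ (baseChangeHom τ).map (S.M.map f)) z₁' = AlgPoints.map (inj c) z₁ ∧
          AlgPoints.map (inj' c' ≫ (baseChangeHom τ).map (S.M.map f)) z₂' = AlgPoints.map (inj c) z₂ := by
  letI : Algebra L ℂ := τ.toAlgebra
  classical
  obtain ⟨g, hg, X, ι, hcol, B, hB⟩ := S.pieces K
  obtain ⟨g', hg', X', ι', -, B', hB'⟩ := S.pieces K'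
  refine ⟨_, _, X, X', ι, fun q => (B q).isSmoothProjective.geometricallyIrreducible, hcol, ι',
    fun q' => (B' q').isSmoothProjective.geometricallyIrreducible, fun q z₁ z₂ => ?_⟩
  -- every complex point of the piece `X_q` is `[v, g_q K]` for a negative vector `v`
  have hpt : ∀ z : ComplexPoints (X q), ∃ (v : Fin 2 → ℂ) (hv : v ∈ negCone (Jstar.map τ)), AlgPoints.map (ι q) z =
      AlgPoints.baseChangeEquiv τ (S.M.obj K) ((S.pts K).symm (ShimuraSetGS.mk L Jstar τ K.1.1 v hv (g q))) := by
    intro z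
    obtain ⟨hH, -, hpts⟩ := hB q
    obtain ⟨w, hw, rfl⟩ := (B q).surjOn_unif (Set.mem_univ z)
    have hw' : w ∈ negCone (Jstar.map τ) := by
      rw [← hH]
      exact hw
    exact ⟨w, hw', hpts w hw'⟩
  -- (the rank-generic representative lemma ★ `UnitaryGroup.exists_rational_smul_rep_mem`, [Milne2005ShimuraVarieties] Lemma 5.13 fn. 41)
  obtain ⟨γ, hγ⟩ := exists_rational_smul_rep_mem hg' (g q)
  -- at level `K'`: the class `q'` of `g_q` and a rational `γ` with `(γ g_q)⁻¹ g'_{q'} ∈ K'`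
  set q' : orbitRel.Quotient ↥(rational (↥(maximalRealSubfield L)) L (IsCMField.complexConj L) 2 Jstar)
      (CosetSpace (rationalToFinAdelic (↥(maximalRealSubfield L)) L (IsCMField.complexConj L) 2 Jstar) K'.1.1) :=
    Quotient.mk'' (CosetSpace.pt (rationalToFinAdelic (↥(maximalRealSubfield L)) L (IsCMField.complexConj L) 2 Jstar) K'.1.1 (g q))
    with hq'
  -- `[v, g_q K'] = [γ^τ v, g'_{q'} K']`
  have hneg : ∀ (v : Fin 2 → ℂ) (hv : v ∈ negCone (Jstar.map τ)),
      (1 : ℂ) • ((((ratToGLℂ L Jstar τ γ : GL (Fin 2) ℂ)) : Matrix (Fin 2) (Fin 2) ℂ) *ᵥ v) ∈ negCone (Jstar.map τ) :=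
    fun v hv => smul_ratToGLℂ_mulVec_mem_negCone L Jstar τ γ one_ne_zero hv
  have hmk : ∀ (v : Fin 2 → ℂ) (hv : v ∈ negCone (Jstar.map τ)),
      ShimuraSetGS.mk L Jstar τ K'.1.1 v hv (g q) = ShimuraSetGS.mk L Jstar τ K'.1.1 _ (hneg v hv) (g' q') := by
    intro v hv
    rw [← ShimuraSetGS.mk_smul_mulVec L Jstar τ K'.1.1 γ one_ne_zero v hv (hneg v hv) (g q),
      ← ShimuraSetGS.mk_mul_of_mem L Jstar τ K'.1.1 _ (hneg v hv) _ hγ, mul_inv_cancel_left]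
  -- the points `unif' (γ^τ v)` of the piece `X'_{q'}` map to `[v, g_q K]` under the transition
  have hlift : ∀ (v : Fin 2 → ℂ) (hv : v ∈ negCone (Jstar.map τ)),
      AlgPoints.map (ι' q' ≫ (baseChangeHom τ).map (S.M.map f)) ((B' q').unif ((1 : ℂ) •
        ((((ratToGLℂ L Jstar τ γ : GL (Fin 2) ℂ)) : Matrix (Fin 2) (Fin 2) ℂ) *ᵥ v))) =
      AlgPoints.baseChangeEquiv τ (S.M.obj K) ((S.pts K).symm (ShimuraSetGS.mk L Jstar τ K.1.1 v hv (g q))) := by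
    intro v hv
    obtain ⟨-, -, hpts'⟩ := hB' q'
    rw [AlgPoints.map_comp_apply, hpts' _ (hneg v hv), ← hmk v hv,
      ← Literature.AlgebraicGeometry.HodgeTheory.baseChangeEquiv_map (S.M.map f), S.map_pts_symm f v hv (g q)]
  obtain ⟨v₁, hv₁, hx₁⟩ := hpt z₁
  obtain ⟨v₂, hv₂, hx₂⟩ := hpt z₂
  exact ⟨q', _, _, (hlift v₁ hv₁).trans hx₁.symm, (hlift v₂ hv₂).trans hx₂.symm⟩

end RecordSystemGS

end UnitaryCanonicalModel

end Literature.AlgebraicGeometry.ShimuraVarieties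

end
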